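import Summits.MatrixMultiplication.OmegaCensus.TorusFiveNinthsTheorem
import Summits.MatrixMultiplication.OmegaCensus.PairWallFiveNinths

/-!
# ω-census (tpp lane): the PAIR BOUND `PairSatTPP p u a c B → 27·|B| ≤ 5·p`, hence C6″ for every `p ≢ 22 (mod 27)`

Contributed by the speedrun lane `tpp` (summit MatrixMultiplication), seat `sr-tpp-search-g22` (2026-08-24; source
`run/shared/lean/speedrun/tpp/sr-tpp-search-g22/lean/TorusFiveNinthsProof.lean` v3, 914 lines, sha256
`8246c8148034ac501ead741d201aede3e556ac7f950f8d9e828748e18e85fd2b`, farm `lean check` rc 0, axioms `propext`, `Classical.choice`, `Quot.sound` only),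
split into three tree files (`TorusFiveNinthsTheorem` §§1–5, `TorusPairBound` §6, `TorusTransversalEquiv` §§7–9) and restyled by seat
`sr-tpp-search-g30` (2026-08-26: the verbatim copies of `upFace` / `ValidUp` / `FiveNinthsTorus` / `PairSatTPP` / `FiveNinthsPairBound` that made
the lane file self-contained are DROPPED — every theorem now speaks about the tree declarations of `TorusFiveNinths.lean` and
`PairWallFiveNinths.lean` directly; a docstring on every declaration; proofs unchanged).
Framing: lottery ticket; floor = certified bounds/negative ranges.  Nothing in this file is progress on `ω`; it records STRUCTURE of the small-group TPP census (lane documents `run/shared/lean/speedrun/tpp/STRUCTURE.md`, `WRITEUP-A.md`).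

CONTENT (§6 of the lane file; the reformulation lemma of `sr-tpp-search-g22/Q6-CERTIFICATE.md` §7).  Normalise a saturated pair-type TPP
triple `({a}C3, {c}C3, B·C3)` of `ℤ_p ⋊_u C3` (tree predicate `PairLaw.PairSatTPP`, `PairWallFiveNinths.lean`) to a VALID, μ₃-symmetric set
`U'' = B'' ∪ uB'' ∪ u²B'' ⊂ ℤ_p` missing `0`, with `|U''| = 3|B|` (`B'' = τ·(B − c)`, `τ = ((1−u)(c−a))⁻¹`): `pair_to_torus`.  Then
`TorusDensity.Proof.fiveNinthsTorus` gives `27·|B| ≤ 5·p` for every prime `p ≡ 1 (mod 3)` (`pairBound_5p`, `fiveNinthsPairBound_weak`), and since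
`27·|B| ≡ 0 (mod 27)` this is the registered bound C6″ `27·|B| ≤ 5(p−1)` (`PairLaw.FiveNinthsPairBound`) whenever `p ≢ 22 (mod 27)`
(`pairBound_pm1`, `fiveNinthsPairBound_of_mod27`).  The converse construction and the exact open residue are in `TorusTransversalEquiv.lean`.
-/

namespace Summit.MatrixMultiplication.OmegaCensus.SpeedrunTPP.TorusDensity.Proof

open Summit.MatrixMultiplication.OmegaCensus.SpeedrunTPP.PairLaw (PairSatTPP)

/-! ## 6. Consequence for the pair wall: `PairSatTPP → 27·|B| ≤ 5·p`, hence C6″ for `p ≢ 22 (mod 27)`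

The reformulation lemma of Q6-CERTIFICATE.md §7: normalise a saturated pair-type TPP triple `({a}C3, {c}C3, B·C3)` of
`ℤ_p ⋊_u C3` to a VALID set `U'' = B'' ∪ uB'' ∪ u²B'' ⊂ ℤ_p` with `|U''| = 3|B|` (`B'' = τ·(B − c)`, `τ = ((1−u)(c−a))⁻¹`),
then apply `fiveNinthsTorus`. -/
section PairBound

variable {p : ℕ}

/-- The normalising map `b ↦ τ (b − c)`. -/
def gmap (τ c : ZMod p) (b : ZMod p) : ZMod p := τ * (b - c)

/-- `B'' = τ (B − c)`. -/
def B2 (τ c : ZMod p) (B : Finset (ZMod p)) : Finset (ZMod p) := B.image (gmap τ c)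

/-- `U'' = B'' ∪ u B'' ∪ u² B''`. -/
def U2 (u τ c : ZMod p) (B : Finset (ZMod p)) : Finset (ZMod p) :=
  B2 τ c B ∪ (B2 τ c B).image (fun x => u * x) ∪ (B2 τ c B).image (fun x => u ^ 2 * x)

/-- Membership in `B'' = τ (B − c)`. -/
theorem mem_B2 {τ c : ZMod p} {B : Finset (ZMod p)} {y : ZMod p} :
    y ∈ B2 τ c B ↔ ∃ b ∈ B, τ * (b - c) = y := by
  simp [B2, gmap]

/-- Membership in `U'' = B'' ∪ uB'' ∪ u²B''`. -/
theorem mem_U2 {u τ c : ZMod p} {B : Finset (ZMod p)} {y : ZMod p} :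
    y ∈ U2 u τ c B ↔ y ∈ B2 τ c B ∨ (∃ x ∈ B2 τ c B, u * x = y) ∨ (∃ x ∈ B2 τ c B, u ^ 2 * x = y) := by
  simp [U2, Finset.mem_union, Finset.mem_image]

/-- `U''` is closed under multiplication by `u`. -/
theorem U2_mul_mem {u τ c : ZMod p} {B : Finset (ZMod p)} (hu3 : u ^ 3 = 1) {y : ZMod p}
    (hy : y ∈ U2 u τ c B) : u * y ∈ U2 u τ c B := by
  rw [mem_U2] at hy ⊢
  rcases hy with h | ⟨x, hx, rfl⟩ | ⟨x, hx, rfl⟩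
  · exact Or.inr (Or.inl ⟨y, h, rfl⟩)
  · exact Or.inr (Or.inr ⟨x, hx, by ring⟩)
  · have e : u * (u ^ 2 * x) = x := by linear_combination x * hu3
    rw [e]; exact Or.inl hx

/-- … hence `u·y ∈ U'' → y ∈ U''`. -/
theorem U2_of_mul_mem {u τ c : ZMod p} {B : Finset (ZMod p)} (hu3 : u ^ 3 = 1) {y : ZMod p}
    (hy : u * y ∈ U2 u τ c B) : y ∈ U2 u τ c B := by
  have h1 := U2_mul_mem hu3 (U2_mul_mem hu3 hy)
  have e : u * (u * (u * y)) = y := by linear_combination y * hu3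
  rwa [e] at h1

/-- … and `u²·y ∈ U'' → y ∈ U''`. -/
theorem U2_of_sq_mul_mem {u τ c : ZMod p} {B : Finset (ZMod p)} (hu3 : u ^ 3 = 1) {y : ZMod p}
    (hy : u ^ 2 * y ∈ U2 u τ c B) : y ∈ U2 u τ c B := by
  have h1 := U2_mul_mem hu3 hy
  have e : u * (u ^ 2 * y) = y := by linear_combination y * hu3
  rwa [e] at h1

/-- **Pair set ⇒ symmetric valid torus set.**  From `PairSatTPP p u a c B` we build a valid, μ₃-symmetric `U'' ∌ 0` with `|U''| = 3|B|`
(`U'' = B'' ∪ uB'' ∪ u²B''`, `B'' = τ (B − c)`, `τ = ((1−u)(c−a))⁻¹`). -/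
theorem pair_to_torus (hp : p.Prime) (u : ZMod p) (hu3 : u ^ 3 = 1) (hu1 : u ≠ 1)
    (a c : ZMod p) (B : Finset (ZMod p)) (h : PairSatTPP p u a c B) :
    ∃ U : Finset (ZMod p), ValidUp p u U ∧ (∀ x ∈ U, u * x ∈ U) ∧ (0 : ZMod p) ∉ U ∧ U.card = 3 * B.card := by
  classical
  haveI : Fact p.Prime := ⟨hp⟩
  rcases B.eq_empty_or_nonempty with rfl | ⟨b₀, hb₀⟩
  · exact ⟨∅, fun x hx => by simp at hx, fun x hx => by simp at hx, by simp, by simp⟩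
  -- units we divide by
  have hd : c - a ≠ 0 := by
    intro hd
    apply h 1 0 (by decide) b₀ hb₀ b₀ hb₀
    simp only [Fin.val_one, Fin.val_zero, pow_one, pow_zero, one_mul]
    linear_combination (u - 1) * hd
  have h1u : (1 : ZMod p) - u ≠ 0 := sub_ne_zero.mpr (Ne.symm hu1)
  have hu0 : u ≠ 0 := by rintro rfl; norm_num at hu3
  have huu : u ^ 2 + u + 1 = 0 := by
    have e : (u - 1) * (u ^ 2 + u + 1) = 0 := by linear_combination hu3
    rcases mul_eq_zero.mp e with h0 | h0
    · exact absurd (sub_eq_zero.mp h0) hu1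
    · exact h0
  set E : ZMod p := (1 - u) * (c - a) with hE
  have hEne : E ≠ 0 := mul_ne_zero h1u hd
  set τ : ZMod p := E⁻¹ with hτ
  have hτE : τ * E = 1 := inv_mul_cancel₀ hEne
  have hτ0 : τ ≠ 0 := inv_ne_zero hEne
  -- the four families of forbidden coincidences, pulled back through τ
  have E1 : ∀ b ∈ B, ∀ b' ∈ B, ∀ l : Fin 3, τ * (b - c) + 1 ≠ u ^ (l : ℕ) * (τ * (b' - c)) := by
    intro b hb b' hb' l heq
    apply h 1 l (by simp) b' hb' b hb
    simp only [Fin.val_one, pow_one]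
    linear_combination (-E) * heq + ((b - c) - u ^ (l : ℕ) * (b' - c)) * hτE
  have E2 : ∀ b ∈ B, ∀ b' ∈ B, ∀ l : Fin 3, τ * (b - c) + 1 + u ≠ u ^ (l : ℕ) * (τ * (b' - c)) := by
    intro b hb b' hb' l heq
    apply h 2 l (by simp) b' hb' b hb
    simp only [Fin.val_two]
    linear_combination (-E) * heq + ((b - c) - u ^ (l : ℕ) * (b' - c)) * hτE
  have D1 : ∀ b ∈ B, ∀ b' ∈ B, u * (τ * (b - c)) ≠ τ * (b' - c) := by
    intro b hb b' hb' heq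
    apply h 0 1 (by decide) b hb b' hb'
    simp only [Fin.val_zero, Fin.val_one, pow_zero, pow_one, one_mul]
    linear_combination E * heq - (u * (b - c) - (b' - c)) * hτE
  have D2 : ∀ b ∈ B, ∀ b' ∈ B, u ^ 2 * (τ * (b - c)) ≠ τ * (b' - c) := by
    intro b hb b' hb' heq
    apply h 0 2 (by decide) b hb b' hb'
    simp only [Fin.val_zero, Fin.val_two, pow_zero, one_mul]
    linear_combination E * heq - (u ^ 2 * (b - c) - (b' - c)) * hτE
  -- consequences at the level of B'' and U''
  have F1 : ∀ x ∈ B2 τ c B, x + 1 ∉ U2 u τ c B := by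
    intro x hx h1
    obtain ⟨b, hb, rfl⟩ := mem_B2.mp hx
    rcases mem_U2.mp h1 with h' | ⟨y, hy, hye⟩ | ⟨y, hy, hye⟩
    · obtain ⟨b', hb', he⟩ := mem_B2.mp h'
      exact E1 b hb b' hb' 0 (by simpa using he.symm)
    · obtain ⟨b', hb', rfl⟩ := mem_B2.mp hy
      exact E1 b hb b' hb' 1 (by simpa using hye.symm)
    · obtain ⟨b', hb', rfl⟩ := mem_B2.mp hy
      exact E1 b hb b' hb' 2 (by simpa using hye.symm)
  have F2 : ∀ x ∈ B2 τ c B, x + 1 + u ∉ U2 u τ c B := by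
    intro x hx h1
    obtain ⟨b, hb, rfl⟩ := mem_B2.mp hx
    rcases mem_U2.mp h1 with h' | ⟨y, hy, hye⟩ | ⟨y, hy, hye⟩
    · obtain ⟨b', hb', he⟩ := mem_B2.mp h'
      exact E2 b hb b' hb' 0 (by simpa using he.symm)
    · obtain ⟨b', hb', rfl⟩ := mem_B2.mp hy
      exact E2 b hb b' hb' 1 (by simpa using hye.symm)
    · obtain ⟨b', hb', rfl⟩ := mem_B2.mp hy
      exact E2 b hb b' hb' 2 (by simpa using hye.symm)
  -- U'' is valid
  have hvalid : ValidUp p u (U2 u τ c B) := by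
    intro x hxU
    rcases mem_U2.mp hxU with hxB | ⟨y, hyB, rfl⟩ | ⟨y, hyB, rfl⟩
    · refine ⟨x, by simp, ?_⟩
      refine Finset.eq_singleton_iff_unique_mem.mpr ⟨Finset.mem_inter.mpr ⟨by simp [upFace], hxU⟩, fun w hw => ?_⟩
      obtain ⟨hwF, hwU⟩ := Finset.mem_inter.mp hw
      simp only [upFace, Finset.mem_insert, Finset.mem_singleton] at hwF
      rcases hwF with rfl | rfl | rfl
      · rfl
      · exact absurd hwU (F1 x hxB)
      · exact absurd hwU (F2 x hxB)
    · refine ⟨u * y - 1, by simp, ?_⟩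
      refine Finset.eq_singleton_iff_unique_mem.mpr ⟨Finset.mem_inter.mpr ⟨by simp [upFace], hxU⟩, fun w hw => ?_⟩
      obtain ⟨hwF, hwU⟩ := Finset.mem_inter.mp hw
      simp only [upFace, Finset.mem_insert, Finset.mem_singleton] at hwF
      rcases hwF with rfl | rfl | rfl
      · have e : u * y - 1 = u * (y + 1 + u) := by linear_combination (-1 : ZMod p) * huu
        rw [e] at hwU
        exact absurd (U2_of_mul_mem hu3 hwU) (F2 y hyB)
      · ring
      · have e : u * y - 1 + 1 + u = u * (y + 1) := by ring
        rw [e] at hwU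
        exact absurd (U2_of_mul_mem hu3 hwU) (F1 y hyB)
    · refine ⟨u ^ 2 * y - 1 - u, by simp, ?_⟩
      have hxF : u ^ 2 * y ∈ upFace p u (u ^ 2 * y - 1 - u) := by
        simp only [upFace]
        exact Finset.mem_insert_of_mem (Finset.mem_insert_of_mem (Finset.mem_singleton.mpr (by ring)))
      refine Finset.eq_singleton_iff_unique_mem.mpr ⟨Finset.mem_inter.mpr ⟨hxF, hxU⟩, fun w hw => ?_⟩
      obtain ⟨hwF, hwU⟩ := Finset.mem_inter.mp hw
      simp only [upFace, Finset.mem_insert, Finset.mem_singleton] at hwF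
      rcases hwF with rfl | rfl | rfl
      · have e : u ^ 2 * y - 1 - u = u ^ 2 * (y + 1) := by linear_combination (-1 : ZMod p) * huu
        rw [e] at hwU
        exact absurd (U2_of_sq_mul_mem hu3 hwU) (F1 y hyB)
      · have e : u ^ 2 * y - 1 - u + 1 = u ^ 2 * (y + 1 + u) := by linear_combination (-u) * huu
        rw [e] at hwU
        exact absurd (U2_of_sq_mul_mem hu3 hwU) (F2 y hyB)
      · ring
  -- |U''| = 3 |B|
  have hg : Function.Injective (gmap τ c) := by
    intro x y hxy
    have := mul_left_cancel₀ hτ0 hxy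
    linear_combination this
  have hcB2 : (B2 τ c B).card = B.card := Finset.card_image_of_injective _ hg
  have hm1 : Function.Injective (fun x : ZMod p => u * x) := fun x y hxy => mul_left_cancel₀ hu0 hxy
  have hm2 : Function.Injective (fun x : ZMod p => u ^ 2 * x) := fun x y hxy => mul_left_cancel₀ (pow_ne_zero 2 hu0) hxy
  have dj1 : Disjoint (B2 τ c B) ((B2 τ c B).image (fun x => u * x)) := by
    refine Finset.disjoint_left.mpr fun x hx hx' => ?_
    obtain ⟨y, hy, rfl⟩ := Finset.mem_image.mp hx'
    obtain ⟨b, hb, rfl⟩ := mem_B2.mp hy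
    obtain ⟨b', hb', he⟩ := mem_B2.mp hx
    exact D1 b hb b' hb' he.symm
  have dj2 : Disjoint (B2 τ c B) ((B2 τ c B).image (fun x => u ^ 2 * x)) := by
    refine Finset.disjoint_left.mpr fun x hx hx' => ?_
    obtain ⟨y, hy, rfl⟩ := Finset.mem_image.mp hx'
    obtain ⟨b, hb, rfl⟩ := mem_B2.mp hy
    obtain ⟨b', hb', he⟩ := mem_B2.mp hx
    exact D2 b hb b' hb' he.symm
  have dj3 : Disjoint ((B2 τ c B).image (fun x => u * x)) ((B2 τ c B).image (fun x => u ^ 2 * x)) := by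
    refine Finset.disjoint_left.mpr fun x hx hx' => ?_
    obtain ⟨y, hy, rfl⟩ := Finset.mem_image.mp hx
    obtain ⟨y', hy', he⟩ := Finset.mem_image.mp hx'
    obtain ⟨b, hb, rfl⟩ := mem_B2.mp hy
    obtain ⟨b', hb', rfl⟩ := mem_B2.mp hy'
    -- he : u^2 * g b' = u * g b  ⇒  u * g b' = g b
    have e2 : u * (u * (τ * (b' - c))) = u * (τ * (b - c)) := by rw [← he]; ring
    exact D1 b' hb' b hb (mul_left_cancel₀ hu0 e2)
  have hcard : (U2 u τ c B).card = 3 * B.card := by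
    rw [U2, Finset.card_union_of_disjoint (Finset.disjoint_union_left.mpr ⟨dj2, dj3⟩),
      Finset.card_union_of_disjoint dj1, Finset.card_image_of_injective _ hm1,
      Finset.card_image_of_injective _ hm2, hcB2]
    ring
  -- 0 ∉ U''  (c ∉ B: taking b = b' = c, k = 0, l = 1 violates the pair law)
  have hcB : c ∉ B := by
    intro hc
    apply h 0 1 (by decide) c hc c hc
    simp only [Fin.val_zero, Fin.val_one, pow_zero, pow_one, one_mul]
    ring
  have zB2 : (0 : ZMod p) ∉ B2 τ c B := by
    intro h0
    obtain ⟨b, hb, he⟩ := mem_B2.mp h0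
    have hbc : b - c = 0 := (mul_eq_zero.mp he).resolve_left hτ0
    exact hcB (sub_eq_zero.mp hbc ▸ hb)
  have h0U : (0 : ZMod p) ∉ U2 u τ c B := by
    intro h0
    rcases mem_U2.mp h0 with h' | ⟨y, hy, hye⟩ | ⟨y, hy, hye⟩
    · exact zB2 h'
    · have : y = 0 := (mul_eq_zero.mp hye).resolve_left hu0
      exact zB2 (this ▸ hy)
    · have : y = 0 := (mul_eq_zero.mp hye).resolve_left (pow_ne_zero 2 hu0)
      exact zB2 (this ▸ hy)
  exact ⟨U2 u τ c B, hvalid, fun x hx => U2_mul_mem hu3 hx, h0U, hcard⟩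

/-- **The pair bound `27·|B| ≤ 5·p`.** -/
theorem pairBound_5p (hp : p.Prime) (hp3 : p % 3 = 1) (u : ZMod p) (hu3 : u ^ 3 = 1) (hu1 : u ≠ 1)
    (a c : ZMod p) (B : Finset (ZMod p)) (h : PairSatTPP p u a c B) : 27 * B.card ≤ 5 * p := by
  obtain ⟨U, hvalid, -, -, hcard⟩ := pair_to_torus hp u hu3 hu1 a c B h
  have main := fiveNinthsTorus p hp hp3 u hu3 hu1 _ hvalid
  omega

/-- **C6″ for `p ≢ 22 (mod 27)`:** the registered pair bound `27·|B| ≤ 5(p−1)` (g21's `FiveNinthsPairBound`, restricted). -/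
theorem pairBound_pm1 (hp : p.Prime) (hp3 : p % 3 = 1) (hp27 : p % 27 ≠ 22) (u : ZMod p) (hu3 : u ^ 3 = 1)
    (hu1 : u ≠ 1) (a c : ZMod p) (B : Finset (ZMod p)) (h : PairSatTPP p u a c B) :
    27 * B.card ≤ 5 * (p - 1) := by
  have h5 := pairBound_5p hp hp3 u hu3 hu1 a c B h
  have hmod : p % 27 % 3 = p % 3 := Nat.mod_mod_of_dvd p (by norm_num : 3 ∣ 27)
  have h27 : p % 27 < 27 := Nat.mod_lt _ (by norm_num)
  generalize hr : p % 27 = r at hmod h27 hp27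
  interval_cases r <;> omega

/-- The restricted form of g21's conjecture `FiveNinthsPairBound`, as a closed statement. -/
theorem fiveNinthsPairBound_of_mod27 :
    ∀ p : ℕ, p.Prime → p % 3 = 1 → p % 27 ≠ 22 → ∀ u : ZMod p, u ^ 3 = 1 → u ≠ 1 →
      ∀ (a c : ZMod p) (B : Finset (ZMod p)), PairSatTPP p u a c B → 27 * B.card ≤ 5 * (p - 1) :=
  fun _ hp hp3 hp27 u hu3 hu1 a c B h => pairBound_pm1 hp hp3 hp27 u hu3 hu1 a c B h

/-- For every prime `p ≡ 1 (mod 3)` (no restriction mod 27): `27·|B| ≤ 5·p`. -/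
theorem fiveNinthsPairBound_weak :
    ∀ p : ℕ, p.Prime → p % 3 = 1 → ∀ u : ZMod p, u ^ 3 = 1 → u ≠ 1 →
      ∀ (a c : ZMod p) (B : Finset (ZMod p)), PairSatTPP p u a c B → 27 * B.card ≤ 5 * p :=
  fun _ hp hp3 u hu3 hu1 a c B h => pairBound_5p hp hp3 u hu3 hu1 a c B h

end PairBound

end Summit.MatrixMultiplication.OmegaCensus.SpeedrunTPP.TorusDensity.Proof
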